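import Mathlib
import HarnessLib

/-!
# Crux `HistoryTailL` (stmt-QuantumFields-19936), K2 organ, row (LP-2): A ONE-SIDED ALMOST-ORTHOGONAL TRANSFER PRESERVES A GEOMETRIC
# LITTLEWOOD–PALEY PROFILE — the real-analysis letter the bandwise Riesz row is consumed through

Cell `ym3-torus` (rung R3 = YM₃ on T³; NOT d = 4, NOT infinite volume, NOT a mass gap, NOT the Clay problem), seat ★w5-19936 g11;
`--supports stmt-QuantumFields-19936 --as helper`; theorems only, definition-free.

WHY.  In the «LP-TOWER» re-cut of the K2 organ (★w2 g11 memo F6-SOCKET §8; LEAD ★w1 g8 WORDS 6–8) the per-level Coulomb re-gauge acts on the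
band components `σ^{(m')}` of the incoming one-form through the block-band pieces `T(m,m') = ‖P_m R P_{m'}‖_{∞→∞}` of the flat Riesz transform
`R = ∇Δ⁻¹∂*` (`P_m = Q⁽ᵐ⁾ − Q⁽ᵐ⁺¹⁾`, block bands).  LOCATED (★w5 g11, 2026-08-29T03:51Z): in sup-norm with block bands the transfer is only
ONE-SIDEDLY almost-orthogonal — `T(m,m') ≤ C_c·L^{−(m−m')}` for coarse output `m ≥ m'` (dipole layers), `T(m,m') ≤ B` uniformly (one band costs
one `log L`), and NO decay for fine output `m < m'` (corner singularity of the plate potential: the RIESZ-LOG logarithm is sharp).  THIS FILE is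
the bookkeeping that such a transfer still maps a geometric input profile `σ_in^{(m')} ≤ ε·r^{m'}` (decreasing towards coarse bands) to a
geometric output profile with the SAME ratio, provided `r·L > 1` (the coarse-side sum `Σ_j (rL)^{−j}` converges) and `r < 1` (the fine-side
tail `Σ_{m'>m} r^{m'}` does): `σ_out^{(m)} ≤ (C_c·(1 − (rL)⁻¹)⁻¹ + B·r·(1 − r)⁻¹)·ε·r^m` — the `log L` inside `B` is paid once per application as
a constant, never as a band or level count.  With ★w3 g12's ratio `r = 2∕L`: `rL = 2`.

WHAT (ns `…Theorems.PoincareLipschitzLPProfileTransport`): §1 `coarse_side_sum_le` (`Σ_{m'≤m} (L⁻¹)^{m−m'} r^{m'} ≤ r^m (1 − (rL)⁻¹)⁻¹`),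
`fine_side_sum_le` (`Σ_{m<m'<N} r^{m'} ≤ r^{m+1}(1−r)⁻¹`); §2 ★★★ `profile_geometric_of_geometric` (LEAD ★w1 g8 RULING 03:52Z: GO; profile window of record `1∕√L < λ < √L`, i.e. here `1∕L < r < 1` bandwise).
HONEST SCOPE.  Pure real arithmetic with the transfer bounds as HYPOTHESES; nothing of (γ1)(γ2) themselves, the LP rows, the charts, h⋆,
`stub_iteratedLipschitz`, `BlockLipschitzL`, `HistoryTailL` is proved.  YM₃ on T³ is rung R3, NOT the Clay problem.
References: T. Bałaban, Commun. Math. Phys. **98** (1985) 17–51 [Balaban1985Averaging] §3 (the multiscale bookkeeping abstracted here);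
M. Giaquinta, *Multiple integrals…* (1983) [Giaquinta1984] Ch. III (the Campanato∕BMO origin of the one-band `log`).
-/

set_option autoImplicit false

open scoped BigOperators
open Finset

namespace Summit.QuantumFields.YangMills.Theorems.PoincareLipschitzLPProfileTransport

/-! ## §1 The two geometric sums -/

/-- **COARSE SIDE**: `Σ_{m' ≤ m} (L⁻¹)^{m−m'}·r^{m'} ≤ r^m·(1 − (rL)⁻¹)⁻¹` for `r > 0`, `rL > 1` (substitute `m' = m − j`:
`r^m Σ_j (rL)^{−j}`). [folklore] -/
theorem coarse_side_sum_le {r L : ℝ} (hr : 0 < r) (hrL : 1 < r * L) (m : ℕ) :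
    ∑ m' ∈ range (m + 1), (L⁻¹) ^ (m - m') * r ^ m' ≤ r ^ m * (1 - (r * L)⁻¹)⁻¹ := by
  have hq0 : 0 ≤ (r * L)⁻¹ := inv_nonneg.2 (by linarith)
  have hq1 : (r * L)⁻¹ < 1 := inv_lt_one_of_one_lt₀ hrL
  -- termwise: `(L⁻¹)^{m−m'} r^{m'} = r^m · ((rL)⁻¹)^{m−m'}` for `m' ≤ m`
  have hterm : ∀ m' ∈ range (m + 1), (L⁻¹) ^ (m - m') * r ^ m' = r ^ m * ((r * L)⁻¹) ^ (m - m') := by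
    intro m' hm'
    have hle : m' ≤ m := Nat.lt_succ_iff.1 (mem_range.1 hm')
    obtain ⟨j, rfl⟩ := Nat.exists_eq_add_of_le hle
    rw [Nat.add_sub_cancel_left, mul_inv, mul_pow, pow_add]
    have hone : r ^ j * (r⁻¹) ^ j = 1 := by rw [← mul_pow, mul_inv_cancel₀ hr.ne', one_pow]
    calc (L⁻¹) ^ j * r ^ m' = (L⁻¹) ^ j * r ^ m' * (r ^ j * (r⁻¹) ^ j) := by rw [hone, mul_one]
      _ = r ^ m' * r ^ j * ((r⁻¹) ^ j * (L⁻¹) ^ j) := by ring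
  rw [sum_congr rfl hterm, ← mul_sum]
  refine mul_le_mul_of_nonneg_left ?_ (pow_nonneg hr.le _)
  -- reindex `j = m − m'` and bound by the full geometric series
  have hre : ∑ m' ∈ range (m + 1), ((r * L)⁻¹) ^ (m - m') = ∑ j ∈ range (m + 1), ((r * L)⁻¹) ^ j := by
    rw [← sum_range_reflect]
    refine sum_congr rfl fun j hj => ?_
    have hj' : j ≤ m := Nat.lt_succ_iff.1 (mem_range.1 hj)
    congr 1
    omega
  rw [hre]
  exact ((summable_geometric_of_lt_one hq0 hq1).sum_le_tsum (range (m + 1)) (fun j _ => pow_nonneg hq0 j)).trans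
    (tsum_geometric_of_lt_one hq0 hq1).le

/-- **FINE SIDE**: `Σ_{m' ∈ range N, m < m'} r^{m'} ≤ r^{m+1}·(1 − r)⁻¹` for `0 ≤ r < 1`, every `N`. [folklore] -/
theorem fine_side_sum_le {r : ℝ} (hr0 : 0 ≤ r) (hr1 : r < 1) (m N : ℕ) :
    ∑ m' ∈ (range N).filter (fun m' => m < m'), r ^ m' ≤ r ^ (m + 1) * (1 - r)⁻¹ := by
  have hsub : (range N).filter (fun m' => m < m') ⊆ (range (m + 1 + N)).image (fun j => m + 1 + j) := by
    intro m' hm'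
    rw [mem_filter, mem_range] at hm'
    rw [mem_image]
    exact ⟨m' - (m + 1), mem_range.2 (by omega), by omega⟩
  calc ∑ m' ∈ (range N).filter (fun m' => m < m'), r ^ m'
      ≤ ∑ m' ∈ (range (m + 1 + N)).image (fun j => m + 1 + j), r ^ m' :=
        sum_le_sum_of_subset_of_nonneg hsub fun _ _ _ => pow_nonneg hr0 _
    _ = ∑ j ∈ range (m + 1 + N), r ^ (m + 1 + j) := by
        rw [sum_image fun a _ b _ h => by simpa using h]
    _ = r ^ (m + 1) * ∑ j ∈ range (m + 1 + N), r ^ j := by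
        rw [mul_sum]; exact sum_congr rfl fun j _ => pow_add _ _ _
    _ ≤ r ^ (m + 1) * (1 - r)⁻¹ := mul_le_mul_of_nonneg_left
        (((summable_geometric_of_lt_one hr0 hr1).sum_le_tsum (range (m + 1 + N)) (fun j _ => pow_nonneg hr0 j)).trans
          (tsum_geometric_of_lt_one hr0 hr1).le) (pow_nonneg hr0 _)

/-! ## §2 The transport of a geometric profile -/

/-- ★★★ **A ONE-SIDED ALMOST-ORTHOGONAL, UNIFORMLY BOUNDED TRANSFER PRESERVES A GEOMETRIC PROFILE WITH `rL > 1`.**  Bands `m, m' < N`;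
transfer `T(m,m')` with `T ≤ C_c·(L⁻¹)^{m−m'}` for `m' ≤ m` (coarse output: almost-orthogonal) and `T ≤ B` for `m < m'`
(fine output: merely bounded); input profile `0 ≤ σ_in(m') ≤ ε·r^{m'}` with `0 < r < 1`, `r·L > 1`; output dominated bandwise,
`σ_out(m) ≤ Σ_{m'<N} T(m,m')·σ_in(m')`.  THEN `σ_out(m) ≤ (C_c·(1 − (rL)⁻¹)⁻¹ + B·r·(1−r)⁻¹)·ε·r^m` for every `m` — the same ratio `r`,
a constant independent of `N` (no band count, no level count). [folklore] [cite: Balaban1985Averaging, §3 (156)–(163) p.40] -/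
theorem profile_geometric_of_geometric {N : ℕ} {T : ℕ → ℕ → ℝ} {σin σout : ℕ → ℝ} {Cc B ε r L : ℝ}
    (hr0 : 0 < r) (hr1 : r < 1) (hrL : 1 < r * L) (hCc : 0 ≤ Cc) (hB : 0 ≤ B) (hε : 0 ≤ ε)
    (hin0 : ∀ m', 0 ≤ σin m') (hin : ∀ m', σin m' ≤ ε * r ^ m')
    (hTcoarse : ∀ m m', m' ≤ m → T m m' ≤ Cc * (L⁻¹) ^ (m - m'))
    (hTfine : ∀ m m', m < m' → T m m' ≤ B)
    (hout : ∀ m, σout m ≤ ∑ m' ∈ range N, T m m' * σin m') (m : ℕ) :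
    σout m ≤ (Cc * (1 - (r * L)⁻¹)⁻¹ + B * r * (1 - r)⁻¹) * ε * r ^ m := by
  have hL0 : 0 ≤ L⁻¹ := inv_nonneg.2 (pos_of_mul_pos_right (by linarith : 0 < r * L) hr0.le).le
  -- split the band sum at `m`
  have hsplit : ∑ m' ∈ range N, T m m' * σin m'
      = ∑ m' ∈ (range N).filter (fun m' => m' ≤ m), T m m' * σin m' + ∑ m' ∈ (range N).filter (fun m' => m < m'), T m m' * σin m' := by
    rw [← sum_filter_add_sum_filter_not (range N) (fun m' => m' ≤ m)]
    congr 1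
    exact sum_congr (by ext m'; simp [not_le]) fun _ _ => rfl
  -- coarse side
  have hcoarse : ∑ m' ∈ (range N).filter (fun m' => m' ≤ m), T m m' * σin m' ≤ Cc * ε * (r ^ m * (1 - (r * L)⁻¹)⁻¹) := by
    calc ∑ m' ∈ (range N).filter (fun m' => m' ≤ m), T m m' * σin m'
        ≤ ∑ m' ∈ (range N).filter (fun m' => m' ≤ m), Cc * (L⁻¹) ^ (m - m') * (ε * r ^ m') :=
          sum_le_sum fun m' hm' => mul_le_mul (hTcoarse m m' (mem_filter.1 hm').2) (hin m') (hin0 m')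
            (mul_nonneg hCc (pow_nonneg hL0 _))
      _ ≤ ∑ m' ∈ range (m + 1), Cc * (L⁻¹) ^ (m - m') * (ε * r ^ m') := by
          refine sum_le_sum_of_subset_of_nonneg (fun m' hm' => ?_) fun m' _ _ => by positivity
          have := (mem_filter.1 hm').2
          exact mem_range.2 (by omega)
      _ = Cc * ε * ∑ m' ∈ range (m + 1), (L⁻¹) ^ (m - m') * r ^ m' := by
          rw [mul_sum]; exact sum_congr rfl fun m' _ => by ring
      _ ≤ Cc * ε * (r ^ m * (1 - (r * L)⁻¹)⁻¹) :=
          mul_le_mul_of_nonneg_left (coarse_side_sum_le hr0 hrL m) (mul_nonneg hCc hε)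
  -- fine side
  have hfine : ∑ m' ∈ (range N).filter (fun m' => m < m'), T m m' * σin m' ≤ B * ε * (r ^ (m + 1) * (1 - r)⁻¹) := by
    calc ∑ m' ∈ (range N).filter (fun m' => m < m'), T m m' * σin m'
        ≤ ∑ m' ∈ (range N).filter (fun m' => m < m'), B * (ε * r ^ m') :=
          sum_le_sum fun m' hm' => mul_le_mul (hTfine m m' (mem_filter.1 hm').2) (hin m') (hin0 m') hB
      _ = B * ε * ∑ m' ∈ (range N).filter (fun m' => m < m'), r ^ m' := by
          rw [mul_sum]; exact sum_congr rfl fun m' _ => by ring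
      _ ≤ B * ε * (r ^ (m + 1) * (1 - r)⁻¹) :=
          mul_le_mul_of_nonneg_left (fine_side_sum_le hr0.le hr1 m N) (mul_nonneg hB hε)
  calc σout m ≤ ∑ m' ∈ range N, T m m' * σin m' := hout m
    _ = _ := hsplit
    _ ≤ Cc * ε * (r ^ m * (1 - (r * L)⁻¹)⁻¹) + B * ε * (r ^ (m + 1) * (1 - r)⁻¹) := add_le_add hcoarse hfine
    _ = (Cc * (1 - (r * L)⁻¹)⁻¹ + B * r * (1 - r)⁻¹) * ε * r ^ m := by rw [pow_succ]; ring

end Summit.QuantumFields.YangMills.Theorems.PoincareLipschitzLPProfileTransport
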